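import Summits.AtomisticToContinuum.HydrodynamicLimit.Theorems.AntiMazurCoboundariesCellForecastPressureDecayContactLayerBoundsA
import HarnessLib

/-!
# S2b · contact-layer bounds for the canonical cell (stub `stub_contactLayerBounds` of the crux line
# `enskog-compensator-martingale`, crux `CellForecastPressureDecay`, stmt-AtomisticToContinuum-13915)

Static volume bounds for the uniform hard-core position law `posLaw σ L n` of `n ≤ 2L³` sphere centres
(closed hard core `σ ≤ 3/16`) in the cube `[0,L]³`, `L ≥ 1` — the registered obligation
`ContactLayerBounds σ`, with the constant `C = 64`:
(a) a given pair of centres is within `σ + r` with probability `≤ C (r + r³) / L³`;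
(b) a given chain `i – j – k` of two such relations (radii `r, r'`) has probability
    `≤ C² (r + r³)(r' + r'³) / L⁶`;
(c) a given centre is within `r` of the boundary of the cube with probability `≤ C r / L`.

Route: by the Ruelle-type bound of the first file (`posLaw_le_two_pow_mul_pi`,
`…ContactLayerBoundsA`) it suffices to price the events for `n` INDEPENDENT uniform points of the cube,
times `2^{#labels} = 4, 8, 2`. Under `ν^{⊗n}` the labels are integrated out one at a time
(`pi_cube_pairEvent_inter_le`, Tonelli): a relative position falls in `T` with probability `≤ vol(T)/L³`
whatever the other point; on the admissible set a pair within `σ + r` has its relative position in the shell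
`σ ≤ |q| ≤ σ + r`, of volume `(4π/3)((σ + r)³ − σ³) ≤ 8 (r + r³)` (`volume_shell_le`); the part of the cube
within `r` of its boundary is covered by six slabs of volume `r L²` (`volume_cellCube_inter_layer_le`).

References: D. Ruelle, *Statistical Mechanics: Rigorous Results* (1969), §4.2; C. Cercignani, R. Illner,
M. Pulvirenti, *The Mathematical Theory of Dilute Gases* (1994), §2–3 (collision cylinders and shells).
-/

noncomputable section

open MeasureTheory ProbabilityTheory Set Filter
open scoped ENNReal BigOperators InnerProductSpace
open Literature.Analysis.FluidPDE Literature.MathematicalPhysics.KineticTheory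
open Literature.MathematicalPhysics.StatisticalMechanics
open Summit.AtomisticToContinuum.HydrodynamicLimit.Theorems.CellForecastPressureDecay
  (cellCube cellCube_eq_preimage measurableSet_cellCube volume_cellCube)

namespace Summit.AtomisticToContinuum.HydrodynamicLimit.Theorems.EnskogCompensator

/-! ## § 1 Few-label events under the power of the uniform law -/

/-- The pair event `{x | x i − x j ∈ T}` is measurable. [folklore] -/
theorem measurableSet_pairEvent_cell {n : ℕ} (i j : Fin n) {T : Set V3} (hT : MeasurableSet T) :
    MeasurableSet {x : Fin n → V3 | x i - x j ∈ T} :=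
  ((measurable_pi_apply i).sub (measurable_pi_apply j)) hT

/-- **Integrating out one label**: for `i ≠ j`, measurable `T` and an event `F` not involving the label
`i`, `ν^{⊗n}({x_i − x_j ∈ T} ∩ F) ≤ (vol T / L³) · ν^{⊗n}(F)` (Tonelli in the label `i`; a translate of `T`
has `ν`-mass `≤ vol T / L³`). [folklore] -/
theorem pi_cube_pairEvent_inter_le {L : ℝ} (hL : 0 < L) {n : ℕ} {i j : Fin n} (hij : i ≠ j)
    {T : Set V3} (hT : MeasurableSet T) {F : Set (Fin n → V3)} (hF : MeasurableSet F)
    (hFdep : ∀ (x : Fin n → V3) (y : V3), Function.update x i y ∈ F ↔ x ∈ F) :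
    Measure.pi (fun _ : Fin n => volume[|cellCube L]) ({x | x i - x j ∈ T} ∩ F) ≤
      (volume (cellCube L))⁻¹ * volume T * Measure.pi (fun _ : Fin n => volume[|cellCube L]) F := by
  classical
  haveI := isProbabilityMeasure_cond_cellCube hL
  have hE := measurableSet_pairEvent_cell (n := n) i j hT
  rw [← lintegral_indicator_one (hE.inter hF),
    lintegral_pi_eq_lintegral_update (volume[|cellCube L]) i (measurable_one.indicator (hE.inter hF))]
  have hinner : ∀ x : Fin n → V3,
      ∫⁻ y, ({x : Fin n → V3 | x i - x j ∈ T} ∩ F).indicator 1 (Function.update x i y) ∂(volume[|cellCube L])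
        ≤ (volume (cellCube L))⁻¹ * volume T * F.indicator 1 x := by
    intro x
    by_cases hx : x ∈ F
    · have hset : (fun y : V3 => ({x : Fin n → V3 | x i - x j ∈ T} ∩ F).indicator
          (1 : (Fin n → V3) → ℝ≥0∞) (Function.update x i y)) = ((fun y : V3 => y - x j) ⁻¹' T).indicator 1 := by
        funext y
        have hy : Function.update x i y ∈ F := (hFdep x y).2 hx
        simp only [Set.indicator, Set.mem_inter_iff, Set.mem_setOf_eq, Set.mem_preimage, Function.update_self,
          Function.update_of_ne hij.symm, Pi.one_apply, hy, and_true]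
      rw [hset, lintegral_indicator_one (measurable_sub_const _ hT), Set.indicator_of_mem hx, Pi.one_apply,
        mul_one]
      exact cond_cellCube_preimage_sub_le L T (x j)
    · have hset : (fun y : V3 => ({x : Fin n → V3 | x i - x j ∈ T} ∩ F).indicator
          (1 : (Fin n → V3) → ℝ≥0∞) (Function.update x i y)) = fun _ => 0 := by
        funext y
        have hy : Function.update x i y ∉ F := fun h => hx ((hFdep x y).1 h)
        rw [Set.indicator_of_notMem (fun h => hy h.2)]
      rw [hset, lintegral_zero]
      exact bot_le
  calc ∫⁻ x, ∫⁻ y, ({x : Fin n → V3 | x i - x j ∈ T} ∩ F).indicator 1 (Function.update x i y)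
        ∂(volume[|cellCube L]) ∂(Measure.pi fun _ : Fin n => volume[|cellCube L])
      ≤ ∫⁻ x, (volume (cellCube L))⁻¹ * volume T * F.indicator 1 x
          ∂(Measure.pi fun _ : Fin n => volume[|cellCube L]) := lintegral_mono hinner
    _ = (volume (cellCube L))⁻¹ * volume T * Measure.pi (fun _ : Fin n => volume[|cellCube L]) F := by
        rw [lintegral_const_mul _ (measurable_one.indicator hF), lintegral_indicator_one hF]

/-- **Two labels**: `ν^{⊗n}{x_i − x_j ∈ T} ≤ vol T / L³` for `i ≠ j`. [folklore] -/
theorem pi_cube_pairEvent_le {L : ℝ} (hL : 0 < L) {n : ℕ} {i j : Fin n} (hij : i ≠ j)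
    {T : Set V3} (hT : MeasurableSet T) :
    Measure.pi (fun _ : Fin n => volume[|cellCube L]) {x | x i - x j ∈ T} ≤
      (volume (cellCube L))⁻¹ * volume T := by
  haveI := isProbabilityMeasure_cond_cellCube hL
  have h := pi_cube_pairEvent_inter_le hL hij hT MeasurableSet.univ (fun _ _ => by simp)
  rwa [Set.inter_univ, measure_univ, mul_one] at h

/-- **Three labels**: `ν^{⊗n}{x_i − x_j ∈ T, x_k − x_j ∈ T'} ≤ (vol T / L³)(vol T' / L³)` for distinct
`i, j, k`. [folklore] -/
theorem pi_cube_tripleEvent_le {L : ℝ} (hL : 0 < L) {n : ℕ} {i j k : Fin n} (hij : i ≠ j) (hjk : j ≠ k)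
    (hik : i ≠ k) {T T' : Set V3} (hT : MeasurableSet T) (hT' : MeasurableSet T') :
    Measure.pi (fun _ : Fin n => volume[|cellCube L]) {x | x i - x j ∈ T ∧ x k - x j ∈ T'} ≤
      (volume (cellCube L))⁻¹ * volume T * ((volume (cellCube L))⁻¹ * volume T') := by
  have hF : MeasurableSet {x : Fin n → V3 | x k - x j ∈ T'} := measurableSet_pairEvent_cell k j hT'
  have hset : {x : Fin n → V3 | x i - x j ∈ T ∧ x k - x j ∈ T'} =
      {x | x i - x j ∈ T} ∩ {x | x k - x j ∈ T'} := rfl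
  rw [hset]
  refine (pi_cube_pairEvent_inter_le hL hij hT hF fun x y => ?_).trans
    (mul_le_mul' le_rfl (pi_cube_pairEvent_le hL hjk.symm hT'))
  simp only [Set.mem_setOf_eq, Function.update_of_ne hik.symm, Function.update_of_ne hij.symm]

/-- **The contact shell is thin**: `vol{q | σ ≤ |q| ≤ σ + r} = (4π/3)((σ + r)³ − σ³) ≤ 8 (r + r³)` for
`0 < σ ≤ 3/16`, `r ≥ 0`. [folklore] -/
theorem volume_shell_le {σ r : ℝ} (hσ : 0 < σ) (hσ' : σ ≤ 3 / 16) (hr : 0 ≤ r) :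
    volume (Metric.closedBall (0 : V3) (σ + r) \ Metric.ball 0 σ) ≤ ENNReal.ofReal (8 * (r + r ^ 3)) := by
  rw [measure_sdiff (Metric.ball_subset_closedBall.trans (Metric.closedBall_subset_closedBall (by linarith)))
      measurableSet_ball.nullMeasurableSet measure_ball_lt_top.ne,
    EuclideanSpace.volume_closedBall_fin_three, EuclideanSpace.volume_ball_fin_three,
    ← ENNReal.ofReal_pow (by linarith), ← ENNReal.ofReal_pow hσ.le,
    ← ENNReal.ofReal_mul (by positivity), ← ENNReal.ofReal_mul (by positivity)]
  refine tsub_le_iff_right.2 ?_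
  rw [← ENNReal.ofReal_add (by positivity) (by positivity)]
  refine ENNReal.ofReal_le_ofReal ?_
  have hσ2r : σ ^ 2 * r ≤ (3 / 16) ^ 2 * r := mul_le_mul_of_nonneg_right (pow_le_pow_left₀ hσ.le hσ' 2) hr
  have hσr2 : σ * r ^ 2 ≤ 3 / 16 * r ^ 2 := mul_le_mul_of_nonneg_right hσ' (sq_nonneg r)
  have hr2 : r ^ 2 ≤ (r + r ^ 3) / 2 := by nlinarith [mul_nonneg hr (sq_nonneg (1 - r))]
  have hr3 : 0 ≤ r ^ 3 := pow_nonneg hr 3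
  have hB : 3 * σ ^ 2 * r + 3 * σ * r ^ 2 + r ^ 3 ≤ 3 / 2 * (r + r ^ 3) := by nlinarith
  have hπ : Real.pi * 4 / 3 ≤ 16 / 3 := by linarith [Real.pi_le_four]
  have key : (Real.pi * 4 / 3) * (3 * σ ^ 2 * r + 3 * σ * r ^ 2 + r ^ 3) ≤ (16 / 3) * (3 / 2 * (r + r ^ 3)) :=
    mul_le_mul hπ hB (by positivity) (by norm_num)
  nlinarith [key]

/-- The boundary layer `{f | ∃ k, f k < r ∨ L − r < f k}` of `ℝ³` is measurable. [folklore] -/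
theorem measurableSet_layer (L r : ℝ) : MeasurableSet {f : Fin 3 → ℝ | ∃ k, f k < r ∨ L - r < f k} := by
  have : {f : Fin 3 → ℝ | ∃ k, f k < r ∨ L - r < f k} = ⋃ k, ({f | f k < r} ∪ {f | L - r < f k}) := by
    ext f; simp
  rw [this]
  exact MeasurableSet.iUnion fun k => (measurableSet_lt (measurable_pi_apply k) measurable_const).union
    (measurableSet_lt measurable_const (measurable_pi_apply k))

/-- A slab of the cube of width `r` across the coordinate `k` (bottom face) has volume `r L²`. [folklore] -/
theorem volume_Icc_update_top (L r : ℝ) (hL : 0 ≤ L) (hr : 0 ≤ r) (k : Fin 3) :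
    volume (Set.Icc (0 : Fin 3 → ℝ) (Function.update (fun _ => L) k r)) = ENNReal.ofReal (r * L ^ 2) := by
  rw [Real.volume_Icc_pi, ← Finset.prod_erase_mul _ _ (Finset.mem_univ k), Function.update_self,
    Finset.prod_congr rfl fun i hi => by rw [Function.update_of_ne (Finset.ne_of_mem_erase hi)]]
  simp only [Pi.zero_apply, sub_zero]
  rw [Finset.prod_const, Finset.card_erase_of_mem (Finset.mem_univ k), Finset.card_univ, Fintype.card_fin,
    ENNReal.ofReal_mul hr, ENNReal.ofReal_pow hL, mul_comm]

/-- A slab of the cube of width `r` across the coordinate `k` (top face) has volume `r L²`. [folklore] -/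
theorem volume_Icc_update_bot (L r : ℝ) (hL : 0 ≤ L) (hr : 0 ≤ r) (k : Fin 3) :
    volume (Set.Icc (Function.update (0 : Fin 3 → ℝ) k (L - r)) (fun _ => L)) = ENNReal.ofReal (r * L ^ 2) := by
  rw [Real.volume_Icc_pi, ← Finset.prod_erase_mul _ _ (Finset.mem_univ k), Function.update_self,
    Finset.prod_congr rfl fun i hi => by rw [Function.update_of_ne (Finset.ne_of_mem_erase hi)]]
  simp only [Pi.zero_apply, sub_zero, sub_sub_cancel]
  rw [Finset.prod_const, Finset.card_erase_of_mem (Finset.mem_univ k), Finset.card_univ, Fintype.card_fin,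
    ENNReal.ofReal_mul hr, ENNReal.ofReal_pow hL, mul_comm]

/-- **The boundary layer is thin**: the part of the cube `[0,L]³` within `r` of its boundary (in some
coordinate) has volume `≤ 6 r L²` (six slabs). [folklore] -/
theorem volume_cellCube_inter_layer_le {L r : ℝ} (hL : 0 < L) (hr : 0 ≤ r) :
    volume (cellCube L ∩ {y : V3 | ∃ k, y k < r ∨ L - r < y k}) ≤ ENNReal.ofReal (6 * (r * L ^ 2)) := by
  have hpre : cellCube L ∩ {y : V3 | ∃ k, y k < r ∨ L - r < y k} = (WithLp.ofLp : V3 → (Fin 3 → ℝ)) ⁻¹'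
      (Set.Icc (0 : Fin 3 → ℝ) (fun _ => L) ∩ {f | ∃ k, f k < r ∨ L - r < f k}) := by
    rw [cellCube_eq_preimage]; rfl
  rw [hpre, (PiLp.volume_preserving_ofLp (Fin 3)).measure_preimage
    ((measurableSet_Icc.inter (measurableSet_layer L r)).nullMeasurableSet)]
  have hcover : Set.Icc (0 : Fin 3 → ℝ) (fun _ => L) ∩ {f | ∃ k, f k < r ∨ L - r < f k} ⊆
      ⋃ k : Fin 3, (Set.Icc (0 : Fin 3 → ℝ) (Function.update (fun _ => L) k r) ∪
        Set.Icc (Function.update (0 : Fin 3 → ℝ) k (L - r)) (fun _ => L)) := by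
    rintro f ⟨hf, k, hk⟩
    rw [Set.mem_Icc] at hf
    refine Set.mem_iUnion.2 ⟨k, ?_⟩
    rcases hk with hk | hk
    · refine Or.inl ⟨hf.1, fun k' => ?_⟩
      by_cases hkk : k' = k
      · subst hkk; rw [Function.update_self]; exact hk.le
      · rw [Function.update_of_ne hkk]; exact hf.2 k'
    · refine Or.inr ⟨fun k' => ?_, hf.2⟩
      by_cases hkk : k' = k
      · subst hkk; rw [Function.update_self]; exact hk.le
      · rw [Function.update_of_ne hkk]; exact hf.1 k'
  have h2 : 0 ≤ r * L ^ 2 := by positivity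
  calc volume (Set.Icc (0 : Fin 3 → ℝ) (fun _ => L) ∩ {f | ∃ k, f k < r ∨ L - r < f k})
      ≤ volume (⋃ k : Fin 3, (Set.Icc (0 : Fin 3 → ℝ) (Function.update (fun _ => L) k r) ∪
          Set.Icc (Function.update (0 : Fin 3 → ℝ) k (L - r)) (fun _ => L))) := measure_mono hcover
    _ ≤ ∑ k : Fin 3, volume (Set.Icc (0 : Fin 3 → ℝ) (Function.update (fun _ => L) k r) ∪
          Set.Icc (Function.update (0 : Fin 3 → ℝ) k (L - r)) (fun _ => L)) :=
        measure_iUnion_fintype_le _ _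
    _ ≤ ∑ k : Fin 3, (volume (Set.Icc (0 : Fin 3 → ℝ) (Function.update (fun _ => L) k r)) +
          volume (Set.Icc (Function.update (0 : Fin 3 → ℝ) k (L - r)) (fun _ => L))) :=
        Finset.sum_le_sum fun k _ => measure_union_le _ _
    _ = ∑ _k : Fin 3, (ENNReal.ofReal (r * L ^ 2) + ENNReal.ofReal (r * L ^ 2)) :=
        Finset.sum_congr rfl fun k _ => by
          rw [volume_Icc_update_top L r hL.le hr k, volume_Icc_update_bot L r hL.le hr k]
    _ = ENNReal.ofReal (6 * (r * L ^ 2)) := by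
        rw [Finset.sum_const, Finset.card_univ, Fintype.card_fin, nsmul_eq_mul, Nat.cast_ofNat,
          ← ENNReal.ofReal_add h2 h2, ← ENNReal.ofReal_ofNat, ← ENNReal.ofReal_mul (by norm_num)]
        congr 1
        ring

/-! ## § 2 The registered stub -/

/-- **S2b · contact-layer bounds** (registered stub `stub_contactLayerBounds` of the line
`enskog-compensator-martingale`): for `0 < σ ≤ 3/16` (and granted the factorisation of the cell law, which is
not used), `ContactLayerBounds σ` holds with `C = 64`: for `L ≥ 1`, `n ≤ 2L³`, under the uniform hard-core
position law of the cell (a) `P{‖xᵢ − xⱼ‖ ≤ σ + r} ≤ C (r + r³)/L³`, (b) `P{‖xᵢ − xⱼ‖ ≤ σ + r, ‖xⱼ − x_k‖ ≤ σ + r'}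
≤ C² (r + r³)(r' + r'³)/L⁶`, (c) `P{xᵢ within r of ∂[0,L]³} ≤ C r / L` — the Ruelle bound `2^{#labels}` times
the independent-points probabilities (shell volume `≤ 8(r + r³)`, boundary layer `≤ 6 r L²`).
[cite: Ruelle1969, §4.2] -/
theorem stub_contactLayerBounds : ∀ σ : ℝ, 0 < σ → σ ≤ 3 / 16 → CellLawFactorises σ → ContactLayerBounds σ := by
  intro σ hσ hσ' _
  refine ⟨64, by norm_num, fun L hL n hn => ?_⟩
  have hL0 : 0 < L := one_pos.trans_le hL
  haveI := isProbabilityMeasure_cond_cellCube hL0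
  have hadm : MeasurableSet (posAdmissible σ L n) := by
    rw [posAdmissible_eq_pi_inter_hardCore]
    exact (MeasurableSet.univ_pi fun _ => measurableSet_cellCube L).inter
      (measurableSet_hardCoreSet (measurableSet_overlap_lt σ) _)
  have hS : ∀ r : ℝ, MeasurableSet (Metric.closedBall (0 : V3) (σ + r) \ Metric.ball 0 σ) := fun r =>
    measurableSet_closedBall.diff measurableSet_ball
  -- on the admissible set a pair at distance `≤ σ + r` has its relative position in the shell
  have hshell : ∀ (r : ℝ) (x : Fin n → V3), x ∈ posAdmissible σ L n → ∀ i j : Fin n, i ≠ j →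
      ‖x i - x j‖ ≤ σ + r → x i - x j ∈ Metric.closedBall (0 : V3) (σ + r) \ Metric.ball 0 σ := by
    intro r x hx i j hij h
    exact ⟨mem_closedBall_zero_iff.2 h, fun h' => (not_lt.2 (hx.1 i j hij)) (mem_ball_zero_iff.1 h')⟩
  have hL3 : 0 ≤ (L ^ 3)⁻¹ := by positivity
  refine ⟨fun r hr i j hij => ?_, fun r r' hr hr' i j k hij hjk hik => ?_, fun r hr i => ?_⟩
  · -- (a) one pair
    have hE : MeasurableSet {x : Fin n → V3 | x i - x j ∈ Metric.closedBall (0 : V3) (σ + r) \ Metric.ball 0 σ} :=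
      measurableSet_pairEvent_cell i j (hS r)
    calc posLaw σ L n {x | ‖x i - x j‖ ≤ σ + r}
        = posLaw σ L n (posAdmissible σ L n ∩ {x | ‖x i - x j‖ ≤ σ + r}) := by
          rw [posLaw_eq_cond_volume, cond_inter_self hadm]
      _ ≤ posLaw σ L n {x | x i - x j ∈ Metric.closedBall (0 : V3) (σ + r) \ Metric.ball 0 σ} :=
          measure_mono fun x hx => hshell r x hx.1 i j hij hx.2
      _ ≤ 2 ^ ({i, j} : Finset (Fin n)).card * Measure.pi (fun _ : Fin n => volume[|cellCube L])
            {x | x i - x j ∈ Metric.closedBall (0 : V3) (σ + r) \ Metric.ball 0 σ} :=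
          posLaw_le_two_pow_mul_pi hσ hσ' hL hn {i, j} hE fun x y hxy => by
            simp only [Set.mem_setOf_eq, hxy i (by simp), hxy j (by simp)]
      _ ≤ 2 ^ ({i, j} : Finset (Fin n)).card * ((volume (cellCube L))⁻¹ *
            volume (Metric.closedBall (0 : V3) (σ + r) \ Metric.ball 0 σ)) := by
          gcongr
          exact pi_cube_pairEvent_le hL0 hij (hS r)
      _ ≤ 4 * (ENNReal.ofReal ((L ^ 3)⁻¹) * ENNReal.ofReal (8 * (r + r ^ 3))) := by
          rw [Finset.card_pair hij, inv_volume_cellCube hL0]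
          gcongr
          · norm_num
          · exact volume_shell_le hσ hσ' hr
      _ = ENNReal.ofReal (4 * ((L ^ 3)⁻¹ * (8 * (r + r ^ 3)))) := by
          rw [← ENNReal.ofReal_mul hL3, ← ENNReal.ofReal_ofNat, ← ENNReal.ofReal_mul (by norm_num)]
      _ ≤ ENNReal.ofReal (64 * (r + r ^ 3) / L ^ 3) := by
          refine ENNReal.ofReal_le_ofReal ?_
          rw [div_eq_mul_inv]
          nlinarith [mul_nonneg (by positivity : (0 : ℝ) ≤ r + r ^ 3) hL3]
  · -- (b) a chain of two pairs
    have hE : MeasurableSet {x : Fin n → V3 | x i - x j ∈ Metric.closedBall (0 : V3) (σ + r) \ Metric.ball 0 σ ∧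
        x k - x j ∈ Metric.closedBall (0 : V3) (σ + r') \ Metric.ball 0 σ} :=
      (measurableSet_pairEvent_cell i j (hS r)).inter (measurableSet_pairEvent_cell k j (hS r'))
    have hcard : ({i, j, k} : Finset (Fin n)).card = 3 := by
      rw [Finset.card_insert_of_notMem (by simp [hij, hik]), Finset.card_pair hjk]
    calc posLaw σ L n {x | ‖x i - x j‖ ≤ σ + r ∧ ‖x j - x k‖ ≤ σ + r'}
        = posLaw σ L n (posAdmissible σ L n ∩ {x | ‖x i - x j‖ ≤ σ + r ∧ ‖x j - x k‖ ≤ σ + r'}) := by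
          rw [posLaw_eq_cond_volume, cond_inter_self hadm]
      _ ≤ posLaw σ L n {x | x i - x j ∈ Metric.closedBall (0 : V3) (σ + r) \ Metric.ball 0 σ ∧
            x k - x j ∈ Metric.closedBall (0 : V3) (σ + r') \ Metric.ball 0 σ} :=
          measure_mono fun x hx => ⟨hshell r x hx.1 i j hij hx.2.1,
            hshell r' x hx.1 k j hjk.symm (by rw [norm_sub_rev]; exact hx.2.2)⟩
      _ ≤ 2 ^ ({i, j, k} : Finset (Fin n)).card * Measure.pi (fun _ : Fin n => volume[|cellCube L])
            {x | x i - x j ∈ Metric.closedBall (0 : V3) (σ + r) \ Metric.ball 0 σ ∧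
              x k - x j ∈ Metric.closedBall (0 : V3) (σ + r') \ Metric.ball 0 σ} :=
          posLaw_le_two_pow_mul_pi hσ hσ' hL hn {i, j, k} hE fun x y hxy => by
            simp only [Set.mem_setOf_eq, hxy i (by simp), hxy j (by simp), hxy k (by simp)]
      _ ≤ 2 ^ ({i, j, k} : Finset (Fin n)).card *
            ((volume (cellCube L))⁻¹ * volume (Metric.closedBall (0 : V3) (σ + r) \ Metric.ball 0 σ) *
              ((volume (cellCube L))⁻¹ * volume (Metric.closedBall (0 : V3) (σ + r') \ Metric.ball 0 σ))) := by
          gcongr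
          exact pi_cube_tripleEvent_le hL0 hij hjk hik (hS r) (hS r')
      _ ≤ 8 * (ENNReal.ofReal ((L ^ 3)⁻¹) * ENNReal.ofReal (8 * (r + r ^ 3)) *
            (ENNReal.ofReal ((L ^ 3)⁻¹) * ENNReal.ofReal (8 * (r' + r' ^ 3)))) := by
          rw [hcard, inv_volume_cellCube hL0]
          gcongr
          · norm_num
          · exact volume_shell_le hσ hσ' hr
          · exact volume_shell_le hσ hσ' hr'
      _ = ENNReal.ofReal (8 * (((L ^ 3)⁻¹ * (8 * (r + r ^ 3))) * ((L ^ 3)⁻¹ * (8 * (r' + r' ^ 3))))) := by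
          rw [← ENNReal.ofReal_mul hL3, ← ENNReal.ofReal_mul hL3, ← ENNReal.ofReal_mul (by positivity),
            ← ENNReal.ofReal_ofNat, ← ENNReal.ofReal_mul (by norm_num)]
      _ ≤ ENNReal.ofReal (64 ^ 2 * (r + r ^ 3) * (r' + r' ^ 3) / L ^ 6) := by
          refine ENNReal.ofReal_le_ofReal ?_
          have hX : 0 ≤ (r + r ^ 3) * (r' + r' ^ 3) * ((L ^ 3)⁻¹ * (L ^ 3)⁻¹) := by positivity
          have hL6 : (L ^ 6)⁻¹ = (L ^ 3)⁻¹ * (L ^ 3)⁻¹ := by rw [← mul_inv, ← pow_add]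
          rw [div_eq_mul_inv, hL6]
          nlinarith [hX]
  · -- (c) the boundary layer
    have hSm : MeasurableSet {y : V3 | ∃ k, y k < r ∨ L - r < y k} :=
      (measurableSet_layer L r).preimage (PiLp.volume_preserving_ofLp (Fin 3)).measurable
    have hE : MeasurableSet {x : Fin n → V3 | ∃ k, x i k < r ∨ L - r < x i k} := hSm.preimage (measurable_pi_apply i)
    have heval : Measure.pi (fun _ : Fin n => volume[|cellCube L]) {x : Fin n → V3 | ∃ k, x i k < r ∨ L - r < x i k} =
        volume[|cellCube L] {y : V3 | ∃ k, y k < r ∨ L - r < y k} :=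
      (measurePreserving_eval (fun _ : Fin n => volume[|cellCube L]) i).measure_preimage hSm.nullMeasurableSet
    calc posLaw σ L n {x | ∃ k, x i k < r ∨ L - r < x i k}
        ≤ 2 ^ ({i} : Finset (Fin n)).card * Measure.pi (fun _ : Fin n => volume[|cellCube L])
            {x | ∃ k, x i k < r ∨ L - r < x i k} :=
          posLaw_le_two_pow_mul_pi hσ hσ' hL hn {i} hE fun x y hxy => by
            simp only [Set.mem_setOf_eq, hxy i (Finset.mem_singleton_self i)]
      _ = 2 * ((volume (cellCube L))⁻¹ * volume (cellCube L ∩ {y : V3 | ∃ k, y k < r ∨ L - r < y k})) := by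
          rw [Finset.card_singleton, pow_one, heval, cond_apply (measurableSet_cellCube L)]
      _ ≤ 2 * (ENNReal.ofReal ((L ^ 3)⁻¹) * ENNReal.ofReal (6 * (r * L ^ 2))) := by
          rw [inv_volume_cellCube hL0]
          gcongr
          exact volume_cellCube_inter_layer_le hL0 hr
      _ = ENNReal.ofReal (2 * ((L ^ 3)⁻¹ * (6 * (r * L ^ 2)))) := by
          rw [← ENNReal.ofReal_mul hL3, ← ENNReal.ofReal_ofNat, ← ENNReal.ofReal_mul (by norm_num)]
      _ ≤ ENNReal.ofReal (64 * r / L) := by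
          refine ENNReal.ofReal_le_ofReal ?_
          have hrL : 0 ≤ r / L := by positivity
          calc 2 * ((L ^ 3)⁻¹ * (6 * (r * L ^ 2))) = 12 * (r / L) := by field_simp; ring
            _ ≤ 64 * (r / L) := by nlinarith [hrL]
            _ = 64 * r / L := by ring

end Summit.AtomisticToContinuum.HydrodynamicLimit.Theorems.EnskogCompensator

end
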